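import Mathlib
import HarnessLib
import HarnessLib.Audit
import Summits.ABC.ABC.Theses.IneffectiveSubspace
import Summits.ABC.ABC.Theorems.TowerFourSubLiouville.Negative.Framing
import Summits.ABC.ABC.Theorems.IneffectiveSubspaceTowerFourSubLiouvilleStubTransfer
import Summits.ABC.ABC.Theorems.IneffectiveSubspaceTowerFourSubLiouvilleCoreIff
import Summits.ABC.ABC.Theorems.IneffectiveSubspaceTowerFourSubLiouvilleStubUlGivesUBQ
import Summits.ABC.ABC.Theorems.IneffectiveSubspaceTowerFourSubLiouvilleStubHallLangGivesUL
import Summits.ABC.ABC.Theorems.IneffectiveSubspaceTowerFourSubLiouvilleStubUlGivesHallLang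
import Summits.ABC.ABC.Theorems.IneffectiveSubspaceTowerFourSubLiouvilleStubAbcGivesUL

/-!
# Line `SketchIdeator5` (idea `cm-hall-lang-transfer`) — crux `IneffectiveSubspace.TowerFourSubLiouville` (stmt-ABC-1649) — skeleton v3

STATUS v3 (lead prover-line-stmt-ABC-1649-a1-0, 2026-08-16/17, cycle 1, after wave 1 + integration): SIX of the seven
registered stubs are CLOSED and imported below — composition stubs `stub_ulGivesUBQ` (p131494, `…StubUlGivesUBQ.lean`) and
`stub_hallLangGivesUL` (p131600, `…StubHallLangGivesUL.lean`); certificates `stub_ulGivesHallLang` (p131834,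
`…StubUlGivesHallLang.lean`) and `stub_abcGivesUL` (p131908, `…StubAbcGivesUL.lean`); stratum S0 `stub_reciprocitySieve`
(p132232, `…StubReciprocitySieve.lean`); and the typed edge `stub_cruxOfHallLang1728` (p132209, `…OfHallLang.lean`, with
`towerFourSubLiouville_of_uniformLjunggren`, `hallLang1728_iff_uniformLjunggren`, `hallLang1728_of_abc`) — all
`Summit.ABC.ABC.Theorems.TowerFourSubLiouville.*`, `--supports stmt-ABC-1649`.  `sorry` occurs ONLY in the core
`stub_hallLang1728` (Hall–Lang for `y² = x³ + Nx` with some exponent: OPEN — Lang 1983; `ABC ⟹` it, p132209; FALSE for every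
exponent `κ < 3/2` by the disprover's identity family, `Negative.HallLangTransfer` p131589, which does not touch `∃ κ`).
Bank in the tree after this cycle: `ABC ⟹ UniformLjunggren ⟺ HallLang1728 ⟹ crux`.  Original v1 header follows.

Lead prover-line-stmt-ABC-1649-a1-0 (2026-08-16), from the round-2 ideator-5 sketch
`Cruxes/TowerFourSubLiouville/SketchIdeator5.lean` and its two cards `Ideas/cm-hall-lang-transfer.md` (the transfer that
composes) and `Ideas/two-division-descent-anchor.md` (strata on the elliptic side; no transfer claimed for the whole crux).

THE CRUX. `TowerFourSubLiouville`: `∃ A < 2, TowerIneq(4, A)`.  By the landed certificate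
`Summit.ABC.ABC.Theorems.TowerFourSubLiouville.towerFourSubLiouville_iff_core` (p87895) it is EQUIVALENT to a uniform
power saving over Liouville for the binomial quartic family (`UBQ η` for one `η > 0`: `|wZ⁴ − vY⁴| > Z^η` whenever
`gcd(vY, wZ) = 1`, `max(v,w) ≤ Z^η`, `Z ≥ Z₀`), and `(∃ η > 0, UBQ η) → crux` is the landed `stub_transfer` (p86153).

THE LINE (genus drop 3 → 1).  A violator `wZ⁴ = vY⁴ + a` of `UBQ η` is
(i) a solution `(x, y) = (wZ², Y)` of the quartic norm equation `x² − d·y⁴ = k` with `d = vw` (NOT a square unless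
    `v, w` are both squares, a corner closed by factorisation) and `k = a·w`, `|d|·|k| ≤ Z^{3η}` — so a UNIFORM
    LJUNGGREN bound `|y| ≤ C·(|d||k|)^K` (`UniformLjunggren`, the card's `C⁺`) contradicts `Y ≍ Z^{1−η/4}` once
    `η < 4/(16K+1)`: this is `stub_ulGivesUBQ` (provable now, M);
(ii) equivalently an INTEGRAL POINT `(X, W) = (d·y², d·x·y)` on the CM curve `W² = X³ + N·X`, `N = d·k ≠ 0`
    (`integralPoint_of_normEquation`, proved below by `linear_combination`), with `|X| = |d|y²`; so HALL–LANG for the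
    `j = 1728` family with ANY exponent (`HallLang1728`: `|X| ≤ C·|N|^κ` for all integral points, all `N ≠ 0`) gives
    `UniformLjunggren` with `K = κ`: this is `stub_hallLangGivesUL` (provable now, S);
(iii) `stub_hallLang1728` — Hall–Lang for `y² = x³ + Nx` with some exponent — is the CORE (OPEN: Lang's integral-point
    conjecture on a one-parameter CM twist family; no engine is claimed by the card; Baker/David elliptic-logarithm
    bounds are `exp(poly N)` — `Literature.Barriers.ABC.BakerMethodBounds` — and Gross–Zagier bounds a rank-1 generator
    only by `ĥ ≪ N^{1/2+ε}`, BarrierNotes-r2-k5 N2).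
Composition: `TowerFourSubLiouville_of h₃ := stub_transfer (h₁ (h₂ h₃))` with `h₁, h₂` the landed Stubs 1–2 (v1 took all
three as hypotheses) — kernel-checked below, concludes the crux BY NAME.

CERTIFICATES (registered so they can land `--supports`; NOT hypotheses of the composition):
`stub_ulGivesHallLang` (the converse `UniformLjunggren → HallLang1728`: an integral point with `x > 0` is `x = d m²`,
`x² + N = d n²`, `d` squarefree, so `n² − d m⁴ = N/d`; the square case `d = 1` gives `x ≤ |N|` by factorisation; so the
two `C⁺` of the card are ONE statement up to the exponent), and `stub_abcGivesUL` (`ABC → UniformLjunggren`: abc on the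
primitive part of `x² = d y⁴ + k` gives `y^{1−3ε} ≪ (|d||k|)^{5/2+2ε}`; so, like the crux (`Negative.Framing.
towerFourSubLiouville_of_abc`), NO stub of this line is refutable short of `¬ABC`).

Disproof.lean used (v16b, cycle 7; read 2026-08-16T23:10Z): the sandwich `crux_of_abc` — honoured (ABC ⟹ every stub, see
`stub_abcGivesUL`); `_false_without_eq` / `_false_without_pos` — honoured (the map needs the equation `wZ⁴ = vY⁴ + a`
verbatim and `v, w > 0` for `k ≠ 0`, `d > 0`); the ceiling `not_ubq_of_three_halves_lt` (uniform `η ≤ 3/2`) and the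
per-form dial (`fixedForms_false_above_two`) — respected: `stub_ulGivesUBQ` produces `η = 4/(16K+17)`-type savings, tiny,
never `> 3/2`; `ubq_false_without_height` — respected (every bound is in `|d||k|`, i.e. in the height, never absolute);
`padeFamily₁/₂`, `hurwitzFamily₁`, `bezoutFamily₃` (identity enemies) map to integral points with `log X/log N ≤ 6/7 < ∞`,
consistent with `HallLang1728` for `κ ≥ 1`; the sporadic record `1423·112575⁴ − 9166·70664⁴ = −52081` maps to
`N = d·k = (1423·9166)·(52081·1423)`, `X = d·Y² ≈ 6.5·10¹⁶`, `log X/log N ≈ 1.02`; the integral point `(338, 6214)` on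
`y² = x³ − 2x` (from `239² − 2·13⁴ = −1`) has `log x/log|N| = 8.4`, so the CONSTANT `C` of `HallLang1728` is doing real
work at small `N` (the card's census: all large ratios occur at `d ≤ 13`).  `-- Targets`: none yet for this line.
-/

set_option linter.dupNamespace false

namespace Summit.ABC.ABC.Cruxes.TowerFourSubLiouville.CMHallLangTransfer

open scoped BigOperators
open Summit.ABC.ABC.Theses.IneffectiveSubspace

/-! ## The statements of the line (named `Prop`s) -/

/-- **`UBQPos`** = `∃ η > 0, UBQ η` (the hypothesis of the landed `stub_transfer`, verbatim): some positive uniform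
saving over Liouville for the binomial quartic family beyond some height. Crux-EQUIVALENT (p87895 with `H = 0`). -/
def UBQPos : Prop :=
  ∃ η : ℝ, 0 < η ∧ ∃ Z₀ : ℕ, ∀ v w Y Z : ℕ, Z₀ ≤ Z → 0 < v → 0 < w → 0 < Y → Nat.Coprime (v * Y) (w * Z) →
    ((max v w : ℕ) : ℝ) ≤ (Z : ℝ) ^ η → w * Z ^ 4 ≠ v * Y ^ 4 →
    (Z : ℝ) ^ η < |((w * Z ^ 4 : ℕ) : ℝ) - ((v * Y ^ 4 : ℕ) : ℝ)|

/-- **`UniformLjunggren`** (the card's `C⁺`, existentially quantified exponent): every solution of the quartic norm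
equation `x² − d·y⁴ = k` over `ℤ` with `d` not a square and `k ≠ 0` has `|y| ≤ C·(|d|·|k|)^K`, for ONE pair `(K, C)`.
(Ljunggren 1942 / Cohn 1997 treat `k = ±1, ±4` per `d`; no uniform-in-`d` size bound is known for any `k`.) OPEN;
implied by `ABC` (`stub_abcGivesUL`). -/
def UniformLjunggren : Prop :=
  ∃ K C : ℝ, 0 < C ∧ ∀ d k x y : ℤ, ¬ IsSquare d → k ≠ 0 → x ^ 2 - d * y ^ 4 = k →
    (|y| : ℝ) ≤ C * ((|d| * |k| : ℤ) : ℝ) ^ K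

/-- **`HallLang1728`** (Hall–Lang for the `j = 1728` family, existentially quantified exponent): every integral point
of `y² = x³ + N·x`, `N ≠ 0`, has `|x| ≤ C·|N|^κ`, for ONE pair `(κ, C)`.  Lang's integral-point conjecture (1983)
restricted to this CM twist family; OPEN. -/
def HallLang1728 : Prop :=
  ∃ κ C : ℝ, 0 < C ∧ ∀ N x y : ℤ, N ≠ 0 → y ^ 2 = x ^ 3 + N * x → (|x| : ℝ) ≤ C * (|N| : ℝ) ^ κ

/-- **Stub 1 · `ULGivesUBQ`** (provable now, M): a uniform Ljunggren bound gives a positive uniform saving. -/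
def ULGivesUBQ : Prop := UniformLjunggren → UBQPos

/-- **Stub 2 · `HallLangGivesUL`** (provable now, S): Hall–Lang for `x³ + Nx` gives uniform Ljunggren (`K = κ`). -/
def HallLangGivesUL : Prop := HallLang1728 → UniformLjunggren

/-- **Certificate · `ULGivesHallLang`** (provable now, M; NOT a hypothesis of the composition): the converse of Stub 2. -/
def ULGivesHallLang : Prop := UniformLjunggren → HallLang1728

/-- **Certificate · `AbcGivesUL`** (provable now, M–L; NOT a hypothesis of the composition): `ABC ⟹ UniformLjunggren`. -/
def AbcGivesUL : Prop := _root_.ABC → UniformLjunggren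

/-- **Edge · `CruxOfHallLang1728`** (the composition with its provable hypotheses discharged).  NOT declared as a
`stub_*` theorem here: the skeleton checker takes the first theorem whose conclusion is the crux as THE skeleton, so a
second one (`HallLang1728 → crux`) would shadow `TowerFourSubLiouville_of`; the edge is the `example` in the wiring section
and lands BY NAME as `Summit.ABC.ABC.Theorems.TowerFourSubLiouville.towerFourSubLiouville_of_hallLang1728`
(`Theorems/IneffectiveSubspaceTowerFourSubLiouvilleOfHallLang.lean`). -/
def CruxOfHallLang1728 : Prop := HallLang1728 → TowerFourSubLiouville

/-- The edge holds (the composition with Stubs 1–2 discharged by the landed theorems); landed verbatim as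
`Summit.ABC.ABC.Theorems.TowerFourSubLiouville.stub_cruxOfHallLang1728` (p132209, `Theorems/…OfHallLang.lean`; registered on the
item with `ledger workitem stub-add`, not through this skeleton — that module is deliberately NOT imported here, so that this
workfile elaborates as soon as the stub files do). -/
theorem cruxOfHallLang1728_holds : CruxOfHallLang1728 :=
  fun h => Summit.ABC.ABC.Theorems.TowerFourSubLiouville.stub_transfer
    (Summit.ABC.ABC.Theorems.TowerFourSubLiouville.stub_ulGivesUBQ
      (Summit.ABC.ABC.Theorems.TowerFourSubLiouville.stub_hallLangGivesUL h))

/-- **Stratum S0 · `ReciprocitySieve`** (card `two-division-descent-anchor`, provable now, S; NOT a hypothesis of the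
composition): necessary local conditions on a coprime violator `w Z⁴ = v Y⁴ + a`, `a > 0` — every prime of `Z` is prime
to `a v` with `−a v ≡ □ (mod p)` (it splits in the 2-division field `ℚ(√(−av))` of `y² = x³ + a v w² x`), and every prime
of `Y` is prime to `a w` with `a w ≡ □ (mod p)`. -/
def ReciprocitySieve : Prop :=
  ∀ a v w Y Z p : ℕ, p.Prime → Nat.Coprime (v * Y) (w * Z) → w * Z ^ 4 = v * Y ^ 4 + a → 0 < a →
    (p ∣ Z → ((a * v : ℕ) : ZMod p) ≠ 0 ∧ IsSquare (-((a * v : ℕ) : ZMod p))) ∧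
    (p ∣ Y → ((a * w : ℕ) : ZMod p) ≠ 0 ∧ IsSquare ((a * w : ℕ) : ZMod p))

/-! ### Name-keyed aliases of the registered statements -/
namespace Registered

/-- Alias of `ULGivesUBQ` keyed by the registered stub name. -/
abbrev stub_ulGivesUBQ : Prop := ULGivesUBQ
/-- Alias of `HallLangGivesUL` keyed by the registered stub name. -/
abbrev stub_hallLangGivesUL : Prop := HallLangGivesUL
/-- Alias of `HallLang1728` (the CORE) keyed by the registered stub name. -/
abbrev stub_hallLang1728 : Prop := HallLang1728
/-- Alias of `ULGivesHallLang` (certificate) keyed by the registered stub name. -/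
abbrev stub_ulGivesHallLang : Prop := ULGivesHallLang
/-- Alias of `AbcGivesUL` (certificate) keyed by the registered stub name. -/
abbrev stub_abcGivesUL : Prop := AbcGivesUL
/-- Alias of `ReciprocitySieve` (stratum S0) keyed by the registered stub name. -/
abbrev stub_reciprocitySieve : Prop := ReciprocitySieve

end Registered

/-! ## Proved glue (no `sorry` in this section) -/

/-- DICTIONARY (i)→(ii): a solution of the norm equation `x² − d y⁴ = k` is the integral point
`(X, W) = (d y², d x y)` on `W² = X³ + (d k)·X`. -/
theorem integralPoint_of_normEquation (d k x y : ℤ) (h : x ^ 2 - d * y ^ 4 = k) :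
    (d * x * y) ^ 2 = (d * y ^ 2) ^ 3 + (d * k) * (d * y ^ 2) := by
  linear_combination (d ^ 2 * y ^ 2) * h

/-- DICTIONARY violator→(i): a solution of `w Z⁴ = v Y⁴ + a` is the solution `(x, y) = (w Z², Y)` of
`x² − (v w)·y⁴ = a w`. -/
theorem normEquation_of_violator (a v w Y Z : ℤ) (h : w * Z ^ 4 = v * Y ^ 4 + a) :
    (w * Z ^ 2) ^ 2 - (v * w) * Y ^ 4 = a * w := by
  linear_combination w * h

/-- DICTIONARY violator→(ii) (the sketch's `integralPoint_of_violator`): a solution of `w Z⁴ = v Y⁴ + a` gives the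
integral point `(v w Y², v w² Y Z²)` on `y² = x³ + (a v w²) x`. -/
theorem integralPoint_of_violator (a v w Y Z : ℤ) (h : w * Z ^ 4 = v * Y ^ 4 + a) :
    (v * w ^ 2 * Y * Z ^ 2) ^ 2 = (v * w * Y ^ 2) ^ 3 + (a * v * w ^ 2) * (v * w * Y ^ 2) := by
  linear_combination (v ^ 2 * w ^ 3 * Y ^ 2) * h

/-! ## The composition (kernel-checked; concludes the crux BY NAME) -/

/-- **`TowerFourSubLiouville_of`** — the glue of the line (v2: Stubs 1–2 are DISCHARGED by the landed theorems
`Summit.ABC.ABC.Theorems.TowerFourSubLiouville.stub_ulGivesUBQ` (p131494) and `….stub_hallLangGivesUL` (p131600); the only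
hypothesis left is the core): Hall–Lang₁₇₂₈ (core) ⟹ uniform Ljunggren (Stub 2) ⟹ a positive uniform binomial-quartic
saving (Stub 1) ⟹ the crux (landed `stub_transfer`, p86153). -/
theorem TowerFourSubLiouville_of (h₃ : Registered.stub_hallLang1728) :
    Summit.ABC.ABC.Theses.IneffectiveSubspace.TowerFourSubLiouville :=
  have h₁ : ULGivesUBQ := Summit.ABC.ABC.Theorems.TowerFourSubLiouville.stub_ulGivesUBQ
  have h₂ : HallLangGivesUL := Summit.ABC.ABC.Theorems.TowerFourSubLiouville.stub_hallLangGivesUL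
  Summit.ABC.ABC.Theorems.TowerFourSubLiouville.stub_transfer (h₁ (h₂ h₃))

/-! ### Stratum S0 helpers (proved inline; the same proofs landed as `Theorems/…StubReciprocitySieve.lean`, p132232 —
that module is deliberately NOT imported, so that this workfile elaborates independently of the farm's build order) -/

/-- If a prime `p` divides `Z` and `gcd(vY, wZ) = 1`, then `p ∤ v` and `p ∤ Y`. -/
theorem sieve_not_dvd_of_dvd_Z {v w Y Z p : ℕ} (hp : p.Prime) (hcop : Nat.Coprime (v * Y) (w * Z))
    (hpZ : p ∣ Z) : ¬ p ∣ v ∧ ¬ p ∣ Y := by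
  have hpWZ : p ∣ w * Z := Dvd.dvd.mul_left hpZ w
  have key : ¬ p ∣ v * Y := fun h =>
    hp.one_lt.ne' (Nat.dvd_one.mp (hcop ▸ Nat.dvd_gcd h hpWZ))
  exact ⟨fun h => key (Dvd.dvd.mul_right h Y), fun h => key (Dvd.dvd.mul_left h v)⟩

/-- If a prime `p` divides `Y` and `gcd(vY, wZ) = 1`, then `p ∤ w` and `p ∤ Z`. -/
theorem sieve_not_dvd_of_dvd_Y {v w Y Z p : ℕ} (hp : p.Prime) (hcop : Nat.Coprime (v * Y) (w * Z))
    (hpY : p ∣ Y) : ¬ p ∣ w ∧ ¬ p ∣ Z := by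
  have hpVY : p ∣ v * Y := Dvd.dvd.mul_left hpY v
  have key : ¬ p ∣ w * Z := fun h =>
    hp.one_lt.ne' (Nat.dvd_one.mp (hcop ▸ Nat.dvd_gcd hpVY h))
  exact ⟨fun h => key (Dvd.dvd.mul_right h Z), fun h => key (Dvd.dvd.mul_left h w)⟩

/-- **S0 at the primes of `Z`.** For a coprime violator `w Z⁴ = v Y⁴ + a` and a prime `p ∣ Z`: `a v ≢ 0 (mod p)` and `−a v`
is a square mod `p` (namely `(v Y²)²`). -/
theorem sieve_at_Z {a v w Y Z p : ℕ} (hp : p.Prime) (hcop : Nat.Coprime (v * Y) (w * Z))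
    (heq : w * Z ^ 4 = v * Y ^ 4 + a) (hpZ : p ∣ Z) :
    ((a * v : ℕ) : ZMod p) ≠ 0 ∧ IsSquare (-((a * v : ℕ) : ZMod p)) := by
  haveI := Fact.mk hp
  obtain ⟨hpv, hpY⟩ := sieve_not_dvd_of_dvd_Z hp hcop hpZ
  have hZ0 : ((Z : ℕ) : ZMod p) = 0 := (ZMod.natCast_eq_zero_iff Z p).mpr hpZ
  have hred : ((v : ℕ) : ZMod p) * (Y : ZMod p) ^ 4 + (a : ZMod p) = 0 := by
    have h := congrArg (fun n : ℕ => (n : ZMod p)) heq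
    simp only [Nat.cast_mul, Nat.cast_pow, Nat.cast_add, hZ0] at h
    rw [← h]; ring
  have hpa : ¬ p ∣ a := by
    intro hpa
    have ha0 : ((a : ℕ) : ZMod p) = 0 := (ZMod.natCast_eq_zero_iff a p).mpr hpa
    have hvY : ((v * Y ^ 4 : ℕ) : ZMod p) = 0 := by
      push_cast; rw [ha0, add_zero] at hred; exact hred
    rw [ZMod.natCast_eq_zero_iff] at hvY
    rcases (Nat.Prime.dvd_mul hp).mp hvY with h | h
    · exact hpv h
    · exact hpY (hp.dvd_of_dvd_pow h)
  refine ⟨?_, ⟨((v : ℕ) : ZMod p) * (Y : ZMod p) ^ 2, ?_⟩⟩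
  · rw [Ne, ZMod.natCast_eq_zero_iff]
    intro h
    rcases (Nat.Prime.dvd_mul hp).mp h with h | h
    · exact hpa h
    · exact hpv h
  · have ha' : ((a : ℕ) : ZMod p) = -(((v : ℕ) : ZMod p) * (Y : ZMod p) ^ 4) := by
      rw [eq_neg_iff_add_eq_zero, add_comm]; exact hred
    push_cast
    rw [ha']
    ring

/-- **S0 at the primes of `Y`.** For a coprime violator `w Z⁴ = v Y⁴ + a` and a prime `p ∣ Y`: `a w ≢ 0 (mod p)` and `a w`
is a square mod `p` (namely `(w Z²)²`). -/
theorem sieve_at_Y {a v w Y Z p : ℕ} (hp : p.Prime) (hcop : Nat.Coprime (v * Y) (w * Z))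
    (heq : w * Z ^ 4 = v * Y ^ 4 + a) (hpY : p ∣ Y) :
    ((a * w : ℕ) : ZMod p) ≠ 0 ∧ IsSquare ((a * w : ℕ) : ZMod p) := by
  haveI := Fact.mk hp
  obtain ⟨hpw, hpZ⟩ := sieve_not_dvd_of_dvd_Y hp hcop hpY
  have hY0 : ((Y : ℕ) : ZMod p) = 0 := (ZMod.natCast_eq_zero_iff Y p).mpr hpY
  have hred : ((w : ℕ) : ZMod p) * (Z : ZMod p) ^ 4 = (a : ZMod p) := by
    have h := congrArg (fun n : ℕ => (n : ZMod p)) heq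
    simp only [Nat.cast_mul, Nat.cast_pow, Nat.cast_add, hY0] at h
    rw [h]; ring
  have hpa : ¬ p ∣ a := by
    intro hpa
    have ha0 : ((a : ℕ) : ZMod p) = 0 := (ZMod.natCast_eq_zero_iff a p).mpr hpa
    have hwZ : ((w * Z ^ 4 : ℕ) : ZMod p) = 0 := by
      push_cast; rw [hred, ha0]
    rw [ZMod.natCast_eq_zero_iff] at hwZ
    rcases (Nat.Prime.dvd_mul hp).mp hwZ with h | h
    · exact hpw h
    · exact hpZ (hp.dvd_of_dvd_pow h)
  refine ⟨?_, ⟨((w : ℕ) : ZMod p) * (Z : ZMod p) ^ 2, ?_⟩⟩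
  · rw [Ne, ZMod.natCast_eq_zero_iff]
    intro h
    rcases (Nat.Prime.dvd_mul hp).mp h with h | h
    · exact hpa h
    · exact hpw h
  · push_cast
    rw [← hred]
    ring

/-! ## Registered stubs (statements fully unfolded) — v3: all but the core CLOSED by the landed theorems; `sorry` lives ONLY in `stub_hallLang1728` -/

/-- Stub 1, registered form (= def `ULGivesUBQ`, unfolded). CLOSED (landed `….Theorems.TowerFourSubLiouville.stub_ulGivesUBQ`, p131494): for a violator put `x = wZ²`, `d = vw`,
`y = Y`, `k = w(wZ⁴ − vY⁴)`; the square case `vw = □` (so `v = s²`, `w = t²` by coprimality) is closed by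
`|t²Z⁴ − s²Y⁴| ≥ tZ² + sY² > Z²`; otherwise `Y ≤ C(vw·w·Z^η)^K ≤ C Z^{4ηK}` against `vY⁴ ≥ Z⁴ − Z^η`;
take `η = 1/(1 + 16·max K 0)`. -/
theorem stub_ulGivesUBQ : (∃ K C : ℝ, 0 < C ∧ ∀ d k x y : ℤ, ¬ IsSquare d → k ≠ 0 → x ^ 2 - d * y ^ 4 = k → (|y| : ℝ) ≤ C * ((|d| * |k| : ℤ) : ℝ) ^ K) → ∃ η : ℝ, 0 < η ∧ ∃ Z₀ : ℕ, ∀ v w Y Z : ℕ, Z₀ ≤ Z → 0 < v → 0 < w → 0 < Y → Nat.Coprime (v * Y) (w * Z) → ((max v w : ℕ) : ℝ) ≤ (Z : ℝ) ^ η → w * Z ^ 4 ≠ v * Y ^ 4 → (Z : ℝ) ^ η < |((w * Z ^ 4 : ℕ) : ℝ) - ((v * Y ^ 4 : ℕ) : ℝ)| :=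
  Summit.ABC.ABC.Theorems.TowerFourSubLiouville.stub_ulGivesUBQ

/-- Stub 2, registered form (= def `HallLangGivesUL`, unfolded). CLOSED (landed `….stub_hallLangGivesUL`, p131600): `(X, W) = (d y², d x y)` lies on
`W² = X³ + (dk) X` (`integralPoint_of_normEquation`), `dk ≠ 0`, so `|d| y² ≤ C |dk|^κ`, and `|y| ≤ y² ≤ |d| y²`. -/
theorem stub_hallLangGivesUL : (∃ κ C : ℝ, 0 < C ∧ ∀ N x y : ℤ, N ≠ 0 → y ^ 2 = x ^ 3 + N * x → (|x| : ℝ) ≤ C * (|N| : ℝ) ^ κ) → ∃ K C : ℝ, 0 < C ∧ ∀ d k x y : ℤ, ¬ IsSquare d → k ≠ 0 → x ^ 2 - d * y ^ 4 = k → (|y| : ℝ) ≤ C * ((|d| * |k| : ℤ) : ℝ) ^ K :=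
  Summit.ABC.ABC.Theorems.TowerFourSubLiouville.stub_hallLangGivesUL

/-- Stub 3, registered form (= def `HallLang1728`, unfolded). CORE; OPEN (Lang's integral-point conjecture on the
`j = 1728` twist family, any exponent). -/
theorem stub_hallLang1728 : ∃ κ C : ℝ, 0 < C ∧ ∀ N x y : ℤ, N ≠ 0 → y ^ 2 = x ^ 3 + N * x → (|x| : ℝ) ≤ C * (|N| : ℝ) ^ κ := by
  sorry

/-- Certificate, registered form (= def `ULGivesHallLang`, unfolded). CLOSED (landed `….stub_ulGivesHallLang`, p131834): converse of Stub 2 via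
`x = d m²`, `x² + N = d n²` (`d` squarefree), `n² − d m⁴ = N/d`; square `d`: `|N| = |n − m²|(n + m²) ≥ x`. -/
theorem stub_ulGivesHallLang : (∃ K C : ℝ, 0 < C ∧ ∀ d k x y : ℤ, ¬ IsSquare d → k ≠ 0 → x ^ 2 - d * y ^ 4 = k → (|y| : ℝ) ≤ C * ((|d| * |k| : ℤ) : ℝ) ^ K) → ∃ κ C : ℝ, 0 < C ∧ ∀ N x y : ℤ, N ≠ 0 → y ^ 2 = x ^ 3 + N * x → (|x| : ℝ) ≤ C * (|N| : ℝ) ^ κ :=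
  Summit.ABC.ABC.Theorems.TowerFourSubLiouville.stub_ulGivesHallLang

/-- Certificate, registered form (= def `AbcGivesUL`, unfolded). CLOSED (landed `….stub_abcGivesUL`, p131908): `ABC ⟹ UniformLjunggren` (K = 7). -/
theorem stub_abcGivesUL : _root_.ABC → ∃ K C : ℝ, 0 < C ∧ ∀ d k x y : ℤ, ¬ IsSquare d → k ≠ 0 → x ^ 2 - d * y ^ 4 = k → (|y| : ℝ) ≤ C * ((|d| * |k| : ℤ) : ℝ) ^ K :=
  Summit.ABC.ABC.Theorems.TowerFourSubLiouville.stub_abcGivesUL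

/-- Stratum S0, registered form (= def `ReciprocitySieve`, unfolded). CLOSED (landed `….Theorems.TowerFourSubLiouville.stub_reciprocitySieve`,
p132232; proved here again inline from `sieve_at_Z` / `sieve_at_Y`):
reduction mod `p` — `p ∣ Z` kills `w Z⁴`, so `a ≡ −v Y⁴` and `−a v ≡ (v Y²)²`; symmetrically at the primes of `Y`. -/
theorem stub_reciprocitySieve : ∀ a v w Y Z p : ℕ, p.Prime → Nat.Coprime (v * Y) (w * Z) → w * Z ^ 4 = v * Y ^ 4 + a → 0 < a → (p ∣ Z → ((a * v : ℕ) : ZMod p) ≠ 0 ∧ IsSquare (-((a * v : ℕ) : ZMod p))) ∧ (p ∣ Y → ((a * w : ℕ) : ZMod p) ≠ 0 ∧ IsSquare ((a * w : ℕ) : ZMod p)) :=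
  fun _a _v _w _Y _Z _p hp hcop heq _ha =>
    ⟨fun hpZ => sieve_at_Z hp hcop heq hpZ, fun hpY => sieve_at_Y hp hcop heq hpY⟩

/-! ### Consistency: each named statement IS its registered stub (definitional unfolding only) -/

theorem ulGivesUBQ_holds : ULGivesUBQ := stub_ulGivesUBQ
theorem hallLangGivesUL_holds : HallLangGivesUL := stub_hallLangGivesUL
theorem hallLang1728_holds : HallLang1728 := stub_hallLang1728
theorem ulGivesHallLang_holds : ULGivesHallLang := stub_ulGivesHallLang
theorem abcGivesUL_holds : AbcGivesUL := stub_abcGivesUL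
theorem reciprocitySieve_holds : ReciprocitySieve := stub_reciprocitySieve

/-- Wiring check: the registered stubs feed `TowerFourSubLiouville_of` as stated (definitional unfolding only). -/
example : Summit.ABC.ABC.Theses.IneffectiveSubspace.TowerFourSubLiouville :=
  TowerFourSubLiouville_of stub_hallLang1728

/-- Wiring check (v1 shape, kept for the record): the three registered composition statements together give the crux. -/
example (h₁ : Registered.stub_ulGivesUBQ) (h₂ : Registered.stub_hallLangGivesUL) (h₃ : Registered.stub_hallLang1728) :
    Summit.ABC.ABC.Theses.IneffectiveSubspace.TowerFourSubLiouville :=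
  Summit.ABC.ABC.Theorems.TowerFourSubLiouville.stub_transfer (h₁ (h₂ h₃))

/-- The bank after cycle 1 (UNCONDITIONAL, from the landed stubs): the card's two targets are ONE statement. -/
theorem hallLang1728_iff_uniformLjunggren : HallLang1728 ↔ UniformLjunggren :=
  ⟨stub_hallLangGivesUL, stub_ulGivesHallLang⟩

/-- The bank after cycle 1 (UNCONDITIONAL): the CORE is itself `ABC`-implied (`ABC ⟹ UniformLjunggren ⟹ HallLang1728`),
so it cannot be refuted short of `¬ABC`; the line's open input sits between `ABC`-consequences and the crux. -/
theorem hallLang1728_of_abc (habc : _root_.ABC) : HallLang1728 :=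
  stub_ulGivesHallLang (stub_abcGivesUL habc)

/-- Wiring (UNCONDITIONAL, kept as `example`s so that `TowerFourSubLiouville_of` stays the unique skeleton theorem; the
named versions live in `Theorems/IneffectiveSubspaceTowerFourSubLiouvilleOfHallLang.lean`): uniform Ljunggren alone gives
the crux; Hall–Lang₁₇₂₈ alone gives the crux; `ABC` gives the crux through this line. -/
example (h : UniformLjunggren) : Summit.ABC.ABC.Theses.IneffectiveSubspace.TowerFourSubLiouville :=
  Summit.ABC.ABC.Theorems.TowerFourSubLiouville.stub_transfer (stub_ulGivesUBQ h)

example : (∃ κ C : ℝ, 0 < C ∧ ∀ N x y : ℤ, N ≠ 0 → y ^ 2 = x ^ 3 + N * x → (|x| : ℝ) ≤ C * (|N| : ℝ) ^ κ) →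
    Summit.ABC.ABC.Theses.IneffectiveSubspace.TowerFourSubLiouville :=
  fun h => TowerFourSubLiouville_of h

example (habc : _root_.ABC) : Summit.ABC.ABC.Theses.IneffectiveSubspace.TowerFourSubLiouville :=
  TowerFourSubLiouville_of (hallLang1728_of_abc habc)

end Summit.ABC.ABC.Cruxes.TowerFourSubLiouville.CMHallLangTransfer
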